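import Summits.AtomisticToContinuum.HydrodynamicLimit.Theorems.ImplosionDichotomyDenseExcursionConeLocalityAlgebra
import Summits.AtomisticToContinuum.HydrodynamicLimit.Theorems.ImplosionDichotomyDenseExcursionConeLocalityWeight

/-!
# Cone locality for the athermal `5 × 5` Euler system — the weighted energy inequality on a time slice

Crux `Summit.AtomisticToContinuum.HydrodynamicLimit.Theses.ImplosionDichotomy.DenseExcursion`
(stmt-AtomisticToContinuum-12586), line `kidder-knob-melnikov`, stub `stub_coneLocality : HsEulerConeLocality`.
This file is the system-specific heart of Dafermos's energy method (Hyperbolic Conservation Laws in Continuum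
Physics, 2nd ed. 2005, proof of Thm 5.2.1) for the primitive full Euler system of a monatomic fluid with a general
pressure law `p = P Θ ζ(P)`, `∂_P p = Θ γ(P)` (`ζ, γ ∈ C¹(ℝ)` arbitrary here):

  `∂ₜP + U·∇P + P div U = 0`, `P(∂ₜU + (U·∇)U) + Θγ(P)∇P + Pζ(P)∇Θ = 0`, `∂ₜΘ + U·∇Θ + (2/3)Θζ(P) div U = 0`.

* `energy_algebra5` — the pointwise algebra: with the RESCALED Friedrichs symmetriser `diag(Θ²γ, P²Θ·1₃, 3P²/2)`
  (the usual `diag(Θγ/P, P, 3P/(2Θ))` times `PΘ`, so that no division occurs) the time derivative of the relative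
  energy `ẽ = ½(Θ²γ(P) α² + P²Θ|w|² + (3/2)P²β²)` of the difference `(α, w, β)` of two solutions is a transport
  term plus two exact acoustic divergences plus an explicit ZERO-ORDER remainder;
* `flux_nonpos5` — the boundary flux has the good sign once the cone recedes at speed `≥ ‖U‖ + c_s`,
  `c_s² = Θγ + (2/3)Θζ²` (Cauchy–Schwarz: `Θ(Θγα + Pζβ)² ≤ c_s²(Θ²γα² + (3/2)P²β²)`);
* `slice_integral_le5` — the weighted energy inequality `∫ (ψ ẽ + φ ∂ₜẽ) ≤ M ∫ φ ẽ` on a time slice, given the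
  pointwise bound `source ≤ M ẽ` on the support of the weight (supplied by the caller from compactness).

Theorem-only file; the generic integrations by parts are `ConeLocality.integral_transport_gen` /
`IsentropicEuler.integral_flux`.
-/

noncomputable section

open Set Filter MeasureTheory Metric
open scoped Topology ContDiff RealInnerProductSpace

namespace Summit.AtomisticToContinuum.HydrodynamicLimit.Theorems.KidderKnobMelnikov

namespace ConeLocality

open Literature.Analysis.FluidPDE.IsentropicEuler
open Literature.MathematicalPhysics.KineticTheory (V3)

/-! ### The weighted energy inequality on a time slice -/

set_option maxHeartbeats 1600000 in
/-- **The weighted energy inequality on a time slice** for the `5 × 5` system (the heart of the energy method). At a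
fixed time let `φ ≥ 0` be a `C¹` weight supported in `‖y − x₀‖ < R`, `ψ` (the time derivative of the space–time
weight) continuous, vanishing with `φ`, with `ψ + c‖Dφ‖ ≤ 0`; let `(P, U, Θ)`, `(P₂, U₂, Θ₂)` be `C¹` fields with
space derivatives `LP, AU, LΘ, …` whose "time derivatives" `dP, dU, dΘ, …` solve the primitive system wherever
`φ ≠ 0`, with `Θ, γ(P) ≥ 0`, `‖U‖ + c_s ≤ c` and the zero-order SOURCE bounded by `M ẽ` there (`ẽ` the rescaled
relative energy, `dk, dm, dn` the time derivatives of its three weights, `Lk, Lm, Ln, La, Lb` the space derivatives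
of the weights and of the two flux coefficients `PΘ²γ(P)`, `P²Θζ(P)`). Then `∫ (ψ ẽ + φ ∂ₜẽ) ≤ M ∫ φ ẽ`.
[cite: Dafermos2005, §5.2, proof of Thm 5.2.1, (5.2.10)–(5.2.14)] -/
theorem slice_integral_le5 : ∀ {ζ γ : ℝ → ℝ} {φ ψ P Θ P₂ Θ₂ dP dΘ dP₂ dΘ₂ dk dm dn e src : V3 → ℝ}
    {U U₂ dU dU₂ : V3 → V3} {LP LΘ LP₂ LΘ₂ Lk Lm Ln La Lb : V3 → V3 →L[ℝ] ℝ} {AU AU₂ : V3 → V3 →L[ℝ] V3}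
    {x₀ : V3} {R c M : ℝ},
    ContDiff ℝ 1 ζ → ContDiff ℝ 1 γ → ContDiff ℝ 1 φ → (∀ y, 0 ≤ φ y) → (∀ y, φ y ≠ 0 → ‖y - x₀‖ < R) →
    Continuous ψ → (∀ y, φ y = 0 → ψ y = 0) → (∀ y, ψ y + c * ‖fderiv ℝ φ y‖ ≤ 0) →
    ContDiff ℝ 1 P → ContDiff ℝ 1 Θ → ContDiff ℝ 1 U → ContDiff ℝ 1 P₂ → ContDiff ℝ 1 Θ₂ → ContDiff ℝ 1 U₂ →
    (∀ y, HasFDerivAt P (LP y) y) → (∀ y, HasFDerivAt Θ (LΘ y) y) → (∀ y, HasFDerivAt U (AU y) y) →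
    (∀ y, HasFDerivAt P₂ (LP₂ y) y) → (∀ y, HasFDerivAt Θ₂ (LΘ₂ y) y) → (∀ y, HasFDerivAt U₂ (AU₂ y) y) →
    (∀ y, HasFDerivAt (fun y => Θ y ^ 2 * γ (P y)) (Lk y) y) →
    (∀ y, HasFDerivAt (fun y => P y ^ 2 * Θ y) (Lm y) y) →
    (∀ y, HasFDerivAt (fun y => 3 / 2 * P y ^ 2) (Ln y) y) →
    (∀ y, HasFDerivAt (fun y => P y * Θ y ^ 2 * γ (P y)) (La y) y) →
    (∀ y, HasFDerivAt (fun y => P y ^ 2 * Θ y * ζ (P y)) (Lb y) y) →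
    Continuous dP → Continuous dΘ → Continuous dU → Continuous dP₂ → Continuous dΘ₂ → Continuous dU₂ →
    Continuous dk → Continuous dm → Continuous dn →
    (∀ y, e y = 1 / 2 * (Θ y ^ 2 * γ (P y) * (P y - P₂ y) ^ 2 + P y ^ 2 * Θ y * ‖U y - U₂ y‖ ^ 2 +
      3 / 2 * P y ^ 2 * (Θ y - Θ₂ y) ^ 2)) →
    (∀ y, src y = (∑ i, AU y (EuclideanSpace.single i 1) i) * e y +
      (P y - P₂ y) * La y (U y - U₂ y) + (Θ y - Θ₂ y) * Lb y (U y - U₂ y) +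
      (-(Θ y ^ 2 * γ (P y) * (P y - P₂ y) * LP₂ y (U y - U₂ y)) -
        Θ y ^ 2 * γ (P y) * (P y - P₂ y) ^ 2 * ∑ i, AU₂ y (EuclideanSpace.single i 1) i -
        P y ^ 2 * Θ y * ⟪U y - U₂ y, AU₂ y (U y - U₂ y)⟫ -
        P y * Θ y * (P y - P₂ y) * ⟪U y - U₂ y, AU₂ y (U₂ y)⟫ -
        P y * Θ y * ((Θ y - Θ₂ y) * γ (P y) + Θ₂ y * (γ (P y) - γ (P₂ y))) * LP₂ y (U y - U₂ y) -
        P y * Θ y * ((P y - P₂ y) * ζ (P y) + P₂ y * (ζ (P y) - ζ (P₂ y))) * LΘ₂ y (U y - U₂ y) -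
        P y * Θ y * (P y - P₂ y) * ⟪U y - U₂ y, dU₂ y⟫ -
        3 / 2 * P y ^ 2 * (Θ y - Θ₂ y) * LΘ₂ y (U y - U₂ y) -
        P y ^ 2 * (Θ y - Θ₂ y) * ((Θ y - Θ₂ y) * ζ (P y) + Θ₂ y * (ζ (P y) - ζ (P₂ y))) *
          ∑ i, AU₂ y (EuclideanSpace.single i 1) i) +
      1 / 2 * (Lk y (U y) * (P y - P₂ y) ^ 2 + Lm y (U y) * ‖U y - U₂ y‖ ^ 2 +
        Ln y (U y) * (Θ y - Θ₂ y) ^ 2) +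
      1 / 2 * (dk y * (P y - P₂ y) ^ 2 + dm y * ‖U y - U₂ y‖ ^ 2 + dn y * (Θ y - Θ₂ y) ^ 2)) →
    (∀ y, φ y ≠ 0 →
      (dP y + fderiv ℝ P y (U y) + P y * ∑ i, fderiv ℝ U y (EuclideanSpace.single i 1) i = 0 ∧
        P y • (dU y + fderiv ℝ U y (U y)) + (Θ y * γ (P y)) • gradient P y +
          (P y * ζ (P y)) • gradient Θ y = 0 ∧
        dΘ y + fderiv ℝ Θ y (U y) + 2 / 3 * Θ y * ζ (P y) * ∑ i, fderiv ℝ U y (EuclideanSpace.single i 1) i = 0) ∧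
      (dP₂ y + fderiv ℝ P₂ y (U₂ y) + P₂ y * ∑ i, fderiv ℝ U₂ y (EuclideanSpace.single i 1) i = 0 ∧
        P₂ y • (dU₂ y + fderiv ℝ U₂ y (U₂ y)) + (Θ₂ y * γ (P₂ y)) • gradient P₂ y +
          (P₂ y * ζ (P₂ y)) • gradient Θ₂ y = 0 ∧
        dΘ₂ y + fderiv ℝ Θ₂ y (U₂ y) +
          2 / 3 * Θ₂ y * ζ (P₂ y) * ∑ i, fderiv ℝ U₂ y (EuclideanSpace.single i 1) i = 0)) →
    (∀ y, φ y ≠ 0 → 0 ≤ Θ y ∧ 0 ≤ γ (P y)) →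
    (∀ y, φ y ≠ 0 → ‖U y‖ + Real.sqrt (Θ y * γ (P y) + 2 / 3 * Θ y * ζ (P y) ^ 2) ≤ c) →
    (∀ y, φ y ≠ 0 → src y ≤ M * e y) →
    ∫ y, (ψ y * e y + φ y * (Θ y ^ 2 * γ (P y) * (P y - P₂ y) * (dP y - dP₂ y) +
        P y ^ 2 * Θ y * ⟪U y - U₂ y, dU y - dU₂ y⟫ + 3 / 2 * P y ^ 2 * (Θ y - Θ₂ y) * (dΘ y - dΘ₂ y) +
        1 / 2 * (dk y * (P y - P₂ y) ^ 2 + dm y * ‖U y - U₂ y‖ ^ 2 + dn y * (Θ y - Θ₂ y) ^ 2))) ≤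
      M * ∫ y, φ y * e y := by
  intro ζ γ φ ψ P Θ P₂ Θ₂ dP dΘ dP₂ dΘ₂ dk dm dn e src U U₂ dU dU₂ LP LΘ LP₂ LΘ₂ Lk Lm Ln La Lb AU AU₂ x₀ R c
    M hζ hγ hφ hφ0 hφR hψ hψ0 hsign hP hΘ hU hP₂ hΘ₂ hU₂ hLP hLΘ hAU hLP₂ hLΘ₂ hAU₂ hLk hLm hLn hLa hLb hdP hdΘ
    hdU hdP₂ hdΘ₂ hdU₂ hdk hdm hdn he hsrc hpde hpos hspeed hbound
  -- ### derivative identifications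
  have hLPf : ∀ y, fderiv ℝ P y = LP y := fun y => (hLP y).fderiv
  have hLΘf : ∀ y, fderiv ℝ Θ y = LΘ y := fun y => (hLΘ y).fderiv
  have hAUf : ∀ y, fderiv ℝ U y = AU y := fun y => (hAU y).fderiv
  have hLP₂f : ∀ y, fderiv ℝ P₂ y = LP₂ y := fun y => (hLP₂ y).fderiv
  have hLΘ₂f : ∀ y, fderiv ℝ Θ₂ y = LΘ₂ y := fun y => (hLΘ₂ y).fderiv
  have hAU₂f : ∀ y, fderiv ℝ U₂ y = AU₂ y := fun y => (hAU₂ y).fderiv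
  have hLaf : ∀ y, fderiv ℝ (fun y => P y * Θ y ^ 2 * γ (P y)) y = La y := fun y => (hLa y).fderiv
  have hLbf : ∀ y, fderiv ℝ (fun y => P y ^ 2 * Θ y * ζ (P y)) y = Lb y := fun y => (hLb y).fderiv
  have hαf : ∀ y, fderiv ℝ (fun y => P y - P₂ y) y = LP y - LP₂ y := fun y =>
    ((hLP y).sub (hLP₂ y)).fderiv
  have hβf : ∀ y, fderiv ℝ (fun y => Θ y - Θ₂ y) y = LΘ y - LΘ₂ y := fun y =>
    ((hLΘ y).sub (hLΘ₂ y)).fderiv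
  have hwf : ∀ y, fderiv ℝ (fun y => U y - U₂ y) y = AU y - AU₂ y := fun y =>
    ((hAU y).sub (hAU₂ y)).fderiv
  -- ### regularity of the composite fields
  have ha1 : ContDiff ℝ 1 fun y => P y * Θ y ^ 2 * γ (P y) := by fun_prop
  have hb1 : ContDiff ℝ 1 fun y => P y ^ 2 * Θ y * ζ (P y) := by fun_prop
  have he' : e = fun y => 1 / 2 * (Θ y ^ 2 * γ (P y) * (P y - P₂ y) ^ 2 +
      P y ^ 2 * Θ y * ‖U y - U₂ y‖ ^ 2 + 3 / 2 * P y ^ 2 * (Θ y - Θ₂ y) ^ 2) := funext he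
  have hw2 : ContDiff ℝ 1 fun y => ‖U y - U₂ y‖ ^ 2 := (hU.sub hU₂).norm_sq ℝ
  have he1 : ContDiff ℝ 1 e := by rw [he']; fun_prop
  -- continuity atoms
  have hPc : Continuous P := hP.continuous
  have hΘc : Continuous Θ := hΘ.continuous
  have hUc : Continuous U := hU.continuous
  have hP₂c : Continuous P₂ := hP₂.continuous
  have hΘ₂c : Continuous Θ₂ := hΘ₂.continuous
  have hU₂c : Continuous U₂ := hU₂.continuous
  have hγc : Continuous γ := hγ.continuous
  have hζc : Continuous ζ := hζ.continuous
  have hφc : Continuous φ := hφ.continuous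
  have hDφc : Continuous fun y => fderiv ℝ φ y := hφ.continuous_fderiv one_ne_zero
  have hec : Continuous e := he1.continuous
  have hDec : Continuous fun y => fderiv ℝ e y := he1.continuous_fderiv one_ne_zero
  have hLPc : Continuous fun y => LP y := by
    have h := hP.continuous_fderiv one_ne_zero; rwa [funext hLPf] at h
  have hLΘc : Continuous fun y => LΘ y := by
    have h := hΘ.continuous_fderiv one_ne_zero; rwa [funext hLΘf] at h
  have hAUc : Continuous fun y => AU y := by
    have h := hU.continuous_fderiv one_ne_zero; rwa [funext hAUf] at h
  have hLP₂c : Continuous fun y => LP₂ y := by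
    have h := hP₂.continuous_fderiv one_ne_zero; rwa [funext hLP₂f] at h
  have hLΘ₂c : Continuous fun y => LΘ₂ y := by
    have h := hΘ₂.continuous_fderiv one_ne_zero; rwa [funext hLΘ₂f] at h
  have hAU₂c : Continuous fun y => AU₂ y := by
    have h := hU₂.continuous_fderiv one_ne_zero; rwa [funext hAU₂f] at h
  have hLac : Continuous fun y => La y := by
    have h := ha1.continuous_fderiv one_ne_zero; rwa [funext hLaf] at h
  have hLbc : Continuous fun y => Lb y := by
    have h := hb1.continuous_fderiv one_ne_zero; rwa [funext hLbf] at h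
  have hLkc : Continuous fun y => Lk y := by
    have h1 : ContDiff ℝ 1 fun y => Θ y ^ 2 * γ (P y) := by fun_prop
    have h := h1.continuous_fderiv one_ne_zero
    rwa [funext fun y => (hLk y).fderiv] at h
  have hLmc : Continuous fun y => Lm y := by
    have h1 : ContDiff ℝ 1 fun y => P y ^ 2 * Θ y := by fun_prop
    have h := h1.continuous_fderiv one_ne_zero
    rwa [funext fun y => (hLm y).fderiv] at h
  have hLnc : Continuous fun y => Ln y := by
    have h1 : ContDiff ℝ 1 fun y => 3 / 2 * P y ^ 2 := by fun_prop
    have h := h1.continuous_fderiv one_ne_zero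
    rwa [funext fun y => (hLn y).fderiv] at h
  -- supports
  have hφfar : ∀ y, R < ‖y - x₀‖ → φ y = 0 := fun y hy => by
    by_contra h
    exact lt_asymm (hφR y h) hy
  have hDφ0 : ∀ y, φ y = 0 → fderiv ℝ φ y = 0 := fun y hy => fderiv_eq_zero_of_nonneg hφ0 hy
  -- ### the derivative of the energy density along `U`
  have hfe : ∀ y, fderiv ℝ e y (U y) =
      Θ y ^ 2 * γ (P y) * (P y - P₂ y) * (LP y - LP₂ y) (U y) +
        P y ^ 2 * Θ y * ⟪U y - U₂ y, (AU y - AU₂ y) (U y)⟫ +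
        3 / 2 * P y ^ 2 * (Θ y - Θ₂ y) * (LΘ y - LΘ₂ y) (U y) +
      1 / 2 * (Lk y (U y) * (P y - P₂ y) ^ 2 + Lm y (U y) * ‖U y - U₂ y‖ ^ 2 +
        Ln y (U y) * (Θ y - Θ₂ y) ^ 2) := by
    intro y
    have h : HasFDerivAt (fun y => 1 / 2 * (Θ y ^ 2 * γ (P y) * (P y - P₂ y) ^ 2 +
        P y ^ 2 * Θ y * ‖U y - U₂ y‖ ^ 2 + 3 / 2 * P y ^ 2 * (Θ y - Θ₂ y) ^ 2)) _ y :=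
      ((((hLk y).mul (((hLP y).sub (hLP₂ y)).pow 2)).add
        ((hLm y).mul (((hAU y).sub (hAU₂ y)).norm_sq))).add
        ((hLn y).mul (((hLΘ y).sub (hLΘ₂ y)).pow 2))).const_mul (1 / 2)
    rw [he', h.fderiv]
    simp only [add_apply, smul_apply, sub_apply, ContinuousLinearMap.coe_comp, Function.comp_apply,
      innerSL_apply_apply, smul_eq_mul, nsmul_eq_mul, Nat.cast_ofNat, pow_one, map_sub,
      Nat.add_one_sub_one, Pi.sub_apply, inner_sub_right, inner_sub_left]
    ring
  -- ### names for the pieces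
  set T : V3 → ℝ := fun y => φ y * fderiv ℝ e y (U y) with hT
  set G : V3 → ℝ := fun y => (fderiv ℝ φ y (U y) + φ y * ∑ i, fderiv ℝ U y (EuclideanSpace.single i 1) i) *
    e y with hG
  set Fa : V3 → ℝ := fun y => φ y * (P y * Θ y ^ 2 * γ (P y)) *
    ((P y - P₂ y) * ∑ i, fderiv ℝ (fun y => U y - U₂ y) y (EuclideanSpace.single i 1) i +
      fderiv ℝ (fun y => P y - P₂ y) y (U y - U₂ y)) with hFa
  set Ha : V3 → ℝ := fun y => (P y * Θ y ^ 2 * γ (P y)) * (P y - P₂ y) * fderiv ℝ φ y (U y - U₂ y) +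
    φ y * (P y - P₂ y) * fderiv ℝ (fun y => P y * Θ y ^ 2 * γ (P y)) y (U y - U₂ y) with hHa
  set Fb : V3 → ℝ := fun y => φ y * (P y ^ 2 * Θ y * ζ (P y)) *
    ((Θ y - Θ₂ y) * ∑ i, fderiv ℝ (fun y => U y - U₂ y) y (EuclideanSpace.single i 1) i +
      fderiv ℝ (fun y => Θ y - Θ₂ y) y (U y - U₂ y)) with hFb
  set Hb : V3 → ℝ := fun y => (P y ^ 2 * Θ y * ζ (P y)) * (Θ y - Θ₂ y) * fderiv ℝ φ y (U y - U₂ y) +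
    φ y * (Θ y - Θ₂ y) * fderiv ℝ (fun y => P y ^ 2 * Θ y * ζ (P y)) y (U y - U₂ y) with hHb
  set B : V3 → ℝ := fun y => (∑ i, AU y (EuclideanSpace.single i 1) i) * e y +
    (P y - P₂ y) * La y (U y - U₂ y) + (Θ y - Θ₂ y) * Lb y (U y - U₂ y) with hB
  set dte : V3 → ℝ := fun y => Θ y ^ 2 * γ (P y) * (P y - P₂ y) * (dP y - dP₂ y) +
    P y ^ 2 * Θ y * ⟪U y - U₂ y, dU y - dU₂ y⟫ + 3 / 2 * P y ^ 2 * (Θ y - Θ₂ y) * (dΘ y - dΘ₂ y) +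
    1 / 2 * (dk y * (P y - P₂ y) ^ 2 + dm y * ‖U y - U₂ y‖ ^ 2 + dn y * (Θ y - Θ₂ y) ^ 2) with hdte
  -- ### the pointwise energy identity `φ ∂ₜẽ = −T − Fa − Fb + φ (src − B)`
  have hpt : ∀ y, φ y * dte y = -T y - Fa y - Fb y + φ y * (src y - B y) := by
    intro y
    by_cases hy : φ y = 0
    · simp [hT, hFa, hFb, hy]
    · obtain ⟨⟨hC₁, hM₁, hT₁⟩, hC₂, hM₂, hT₂⟩ := hpde y hy
      rw [hLPf, hAUf] at hC₁
      rw [hAUf] at hM₁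
      rw [hLΘf, hAUf] at hT₁
      rw [hLP₂f, hAU₂f] at hC₂
      rw [hAU₂f] at hM₂
      rw [hLΘ₂f, hAU₂f] at hT₂
      have halg := energy_algebra5 (fun v => (inner_gradient_eq_fderiv P y v).trans (by rw [hLPf]))
        (fun v => (inner_gradient_eq_fderiv Θ y v).trans (by rw [hLΘf]))
        (fun v => (inner_gradient_eq_fderiv P₂ y v).trans (by rw [hLP₂f]))
        (fun v => (inner_gradient_eq_fderiv Θ₂ y v).trans (by rw [hLΘ₂f])) hC₁ hM₁ hT₁ hC₂ hM₂ hT₂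
      simp only [hT, hFa, hFb, hdte, hsrc, hB, hfe y, hαf, hβf, hwf]
      linear_combination (φ y) * halg
  -- ### the three integrations by parts
  have hIT : ∫ y, T y = -∫ y, G y := integral_transport_gen hφ hφfar hU he1
  have hIa : ∫ y, Fa y = -∫ y, Ha y :=
    integral_flux_gen (c := fun y => P y * Θ y ^ 2 * γ (P y)) (s := fun y => P y - P₂ y)
      (w := fun y => U y - U₂ y) hφ hφfar ha1 (hP.sub hP₂) (hU.sub hU₂)
  have hIb : ∫ y, Fb y = -∫ y, Hb y :=
    integral_flux_gen (c := fun y => P y ^ 2 * Θ y * ζ (P y)) (s := fun y => Θ y - Θ₂ y)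
      (w := fun y => U y - U₂ y) hφ hφfar hb1 (hΘ.sub hΘ₂) (hU.sub hU₂)
  -- ### the pointwise sign of the boundary flux
  have hflux : ∀ y, ψ y * e y + G y + Ha y + Hb y - φ y * B y ≤ 0 := by
    intro y
    have hexp : ψ y * e y + G y + Ha y + Hb y - φ y * B y =
        ψ y * e y + fderiv ℝ φ y (U y) * e y +
          (P y * Θ y ^ 2 * γ (P y) * (P y - P₂ y) + P y ^ 2 * Θ y * ζ (P y) * (Θ y - Θ₂ y)) *
            fderiv ℝ φ y (U y - U₂ y) := by
      simp only [hG, hHa, hHb, hB, hAUf, hLaf, hLbf]; ring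
    rw [hexp]
    by_cases hy : φ y = 0
    · rw [hψ0 y hy, hDφ0 y hy]; simp
    · obtain ⟨hΘ0, hγ0⟩ := hpos y hy
      have h := flux_nonpos5 (P := P y) (α := P y - P₂ y) (β := Θ y - Θ₂ y) (w := U y - U₂ y)
        (hsign y) hΘ0 hγ0 (hspeed y hy)
      rw [he y]
      exact h
  -- ### the pointwise source bound
  have hsrcb : ∀ y, φ y * src y ≤ M * (φ y * e y) := by
    intro y
    by_cases hy : φ y = 0
    · rw [hy]; simp
    · have h := mul_le_mul_of_nonneg_left (hbound y hy) (hφ0 y)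
      linarith [h]
  -- ### continuity and integrability (every integrand carries a factor `φ`, `ψ` or `Dφ`)
  have hDUc : Continuous fun y => fderiv ℝ U y := hU.continuous_fderiv one_ne_zero
  have hDwc : Continuous fun y => fderiv ℝ (fun y => U y - U₂ y) y :=
    (hU.sub hU₂).continuous_fderiv one_ne_zero
  have hDαc : Continuous fun y => fderiv ℝ (fun y => P y - P₂ y) y :=
    (hP.sub hP₂).continuous_fderiv one_ne_zero
  have hDβc : Continuous fun y => fderiv ℝ (fun y => Θ y - Θ₂ y) y :=
    (hΘ.sub hΘ₂).continuous_fderiv one_ne_zero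
  have hDac : Continuous fun y => fderiv ℝ (fun y => P y * Θ y ^ 2 * γ (P y)) y :=
    ha1.continuous_fderiv one_ne_zero
  have hDbc : Continuous fun y => fderiv ℝ (fun y => P y ^ 2 * Θ y * ζ (P y)) y :=
    hb1.continuous_fderiv one_ne_zero
  have hsrcc : Continuous src := by rw [funext hsrc]; fun_prop
  have hTc : Continuous T := by simp only [hT]; fun_prop
  have hGc : Continuous G := by simp only [hG]; fun_prop
  have hFac : Continuous Fa := by simp only [hFa]; fun_prop
  have hHac : Continuous Ha := by simp only [hHa]; fun_prop
  have hFbc : Continuous Fb := by simp only [hFb]; fun_prop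
  have hHbc : Continuous Hb := by simp only [hHb]; fun_prop
  have hBc : Continuous B := by simp only [hB]; fun_prop
  have hdtec : Continuous dte := by simp only [hdte]; fun_prop
  have hiψe : Integrable fun y => ψ y * e y :=
    integrable_of_far (hψ.mul hec) fun y hy => by rw [hψ0 y (hφfar y hy), zero_mul]
  have hiT : Integrable T := integrable_of_far hTc fun y hy => by
    simp only [hT]; rw [hφfar y hy, zero_mul]
  have hiG : Integrable G := integrable_of_far hGc fun y hy => by
    simp only [hG]; rw [hφfar y hy, hDφ0 y (hφfar y hy)]; simp
  have hiFa : Integrable Fa := integrable_of_far hFac fun y hy => by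
    simp only [hFa]; rw [hφfar y hy]; ring
  have hiHa : Integrable Ha := integrable_of_far hHac fun y hy => by
    simp only [hHa]; rw [hφfar y hy, hDφ0 y (hφfar y hy)]; simp
  have hiFb : Integrable Fb := integrable_of_far hFbc fun y hy => by
    simp only [hFb]; rw [hφfar y hy]; ring
  have hiHb : Integrable Hb := integrable_of_far hHbc fun y hy => by
    simp only [hHb]; rw [hφfar y hy, hDφ0 y (hφfar y hy)]; simp
  have hiφB : Integrable fun y => φ y * B y :=
    integrable_of_far (hφc.mul hBc) fun y hy => by rw [hφfar y hy, zero_mul]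
  have hiφsrc : Integrable fun y => φ y * src y :=
    integrable_of_far (hφc.mul hsrcc) fun y hy => by rw [hφfar y hy, zero_mul]
  have hiφe : Integrable fun y => φ y * e y :=
    integrable_of_far (hφc.mul hec) fun y hy => by rw [hφfar y hy, zero_mul]
  -- ### assemble
  have hsplit : (fun y => ψ y * e y + φ y * (Θ y ^ 2 * γ (P y) * (P y - P₂ y) * (dP y - dP₂ y) +
      P y ^ 2 * Θ y * ⟪U y - U₂ y, dU y - dU₂ y⟫ + 3 / 2 * P y ^ 2 * (Θ y - Θ₂ y) * (dΘ y - dΘ₂ y) +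
      1 / 2 * (dk y * (P y - P₂ y) ^ 2 + dm y * ‖U y - U₂ y‖ ^ 2 + dn y * (Θ y - Θ₂ y) ^ 2))) =
      fun y => (ψ y * e y - T y - Fa y - Fb y - φ y * B y) + φ y * src y := by
    funext y
    have h := hpt y
    simp only [hdte] at h
    rw [h]; ring
  have h1 : Integrable fun y => ψ y * e y - T y := hiψe.sub hiT
  have h2 : Integrable fun y => ψ y * e y - T y - Fa y := h1.sub hiFa
  have h3 : Integrable fun y => ψ y * e y - T y - Fa y - Fb y := h2.sub hiFb
  have h4 : Integrable fun y => ψ y * e y - T y - Fa y - Fb y - φ y * B y := h3.sub hiφB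
  have g1 : Integrable fun y => ψ y * e y + G y := hiψe.add hiG
  have g2 : Integrable fun y => ψ y * e y + G y + Ha y := g1.add hiHa
  have g3 : Integrable fun y => ψ y * e y + G y + Ha y + Hb y := g2.add hiHb
  have g4 : Integrable fun y => ψ y * e y + G y + Ha y + Hb y - φ y * B y := g3.sub hiφB
  have hMφe : Integrable fun y => M * (φ y * e y) := hiφe.const_mul M
  have eA : ∫ y, (ψ y * e y - T y - Fa y - Fb y - φ y * B y) =
      (∫ y, ψ y * e y) - (∫ y, T y) - (∫ y, Fa y) - (∫ y, Fb y) - ∫ y, φ y * B y := by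
    rw [integral_sub h3 hiφB, integral_sub h2 hiFb, integral_sub h1 hiFa, integral_sub hiψe hiT]
  have eB : ∫ y, (ψ y * e y + G y + Ha y + Hb y - φ y * B y) =
      (∫ y, ψ y * e y) + (∫ y, G y) + (∫ y, Ha y) + (∫ y, Hb y) - ∫ y, φ y * B y := by
    rw [integral_sub g3 hiφB, integral_add g2 hiHb, integral_add g1 hiHa, integral_add hiψe hiG]
  have hneg : ∫ y, (ψ y * e y + G y + Ha y + Hb y - φ y * B y) ≤ 0 := by
    have h := integral_mono g4 (integrable_zero V3 ℝ volume) hflux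
    simpa using h
  have hA : ∫ y, (ψ y * e y - T y - Fa y - Fb y - φ y * B y) ≤ 0 := by
    rw [eA, hIT, hIa, hIb]
    rw [eB] at hneg
    linarith
  have hpos' : ∫ y, φ y * src y ≤ M * ∫ y, φ y * e y := by
    rw [← integral_const_mul]
    exact integral_mono hiφsrc hMφe hsrcb
  rw [hsplit, integral_add h4 hiφsrc]
  linarith

end ConeLocality

end Summit.AtomisticToContinuum.HydrodynamicLimit.Theorems.KidderKnobMelnikov

end
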